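import Mathlib

/-!
# Crux `HilbertIntegralOverconvergentIsCongruence` (stmt-Langlands-8485), line `Sketch-ideate-r1-k1`, RESHAPE 16 (§ T):
# registered stub T3 `stub_spanSupNorm`

Ultrametric linear algebra: the sup-norm principle on the p-adic span from an integral reproducing kernel.
-/

set_option linter.dupNamespace false

noncomputable section

namespace Summit.Langlands.Langlands.Theorems.HilbertIntegralOverconvergentIsCongruence

open scoped NumberField

/-- **Sup-norm (Sturm-type) principle on a `p`-adic span.**
Let `v : E →+* ℚ̄_p` be a ring embedding of a field `E`, `S` a set of `E`-rational multivariable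
power series and `W` a finite window of exponents.  Assume the *integral reproducing kernel*
property `hker`: every coefficient functional `coeff m` agrees on `span_E S` with a combination
`∑_{x ∈ W} κ x • coeff x` whose weights are `v`-integral (`‖v (κ x)‖ ≤ 1`).  Then for every `T` in
the `ℚ̄_p`-span of the `v`-images of `S`, a bound `‖coeff x T‖ ≤ B` on the window `W` propagates to
all coefficients: `‖coeff m T‖ ≤ B`.  Proof: the kernel identity transports to the `ℚ̄_p`-span by
`Submodule.span_induction` (it holds on generators by applying `v`, and both sides are
`ℚ̄_p`-linear), and then the ultrametric inequality bounds `‖∑_{x ∈ W} v (κ x) * coeff x T‖` by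
`max_x ‖v (κ x)‖ * ‖coeff x T‖ ≤ 1 * B`. [folklore] -/
theorem stub_spanSupNorm {E σ : Type} [Field E] (p : ℕ) [Fact p.Prime] (v : E →+* PadicAlgCl p)
    (S : Set (MvPowerSeries σ E)) (W : Finset (σ →₀ ℕ))
    (hker : ∀ m : σ →₀ ℕ, ∃ κ : (σ →₀ ℕ) → E, (∀ x, ‖v (κ x)‖ ≤ 1) ∧
      ∀ A ∈ Submodule.span E S, MvPowerSeries.coeff m A = ∑ x ∈ W, κ x * MvPowerSeries.coeff x A)
    (T : MvPowerSeries σ (PadicAlgCl p))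
    (hT : T ∈ Submodule.span (PadicAlgCl p) (MvPowerSeries.map v '' S))
    (B : ℝ) (hB : 0 ≤ B) (hW : ∀ x ∈ W, ‖MvPowerSeries.coeff x T‖ ≤ B) (m : σ →₀ ℕ) :
    ‖MvPowerSeries.coeff m T‖ ≤ B := by
  obtain ⟨κ, hκ, hid⟩ := hker m
  -- Step 1: the reproducing identity, transported to the `p`-adic span.
  have key : ∀ F ∈ Submodule.span (PadicAlgCl p) (MvPowerSeries.map v '' S),
      MvPowerSeries.coeff m F = ∑ x ∈ W, v (κ x) * MvPowerSeries.coeff x F := by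
    intro F hF
    induction hF using Submodule.span_induction with
    | mem F hF =>
      obtain ⟨A, hA, rfl⟩ := hF
      simp only [MvPowerSeries.coeff_map]
      rw [hid A (Submodule.subset_span hA), map_sum]
      simp only [map_mul]
    | zero => simp
    | add F G _ _ hF hG =>
      rw [map_add, hF, hG, ← Finset.sum_add_distrib]
      refine Finset.sum_congr rfl fun x _ => ?_
      rw [map_add, mul_add]
    | smul a F _ hF =>
      rw [map_smul, hF, smul_eq_mul, Finset.mul_sum]
      refine Finset.sum_congr rfl fun x _ => ?_
      rw [map_smul, smul_eq_mul, mul_left_comm]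
  -- Step 2: the ultrametric bound on the window sum.
  rw [key T hT]
  refine IsUltrametricDist.norm_sum_le_of_forall_le_of_nonneg hB fun x hx => ?_
  rw [norm_mul]
  calc ‖v (κ x)‖ * ‖MvPowerSeries.coeff x T‖ ≤ 1 * B :=
        mul_le_mul (hκ x) (hW x hx) (norm_nonneg _) zero_le_one
    _ = B := one_mul B

end Summit.Langlands.Langlands.Theorems.HilbertIntegralOverconvergentIsCongruence

end
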